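/-
Origin: expansion seat `planner-pub-hodgecm-prl1-g3-0`, handover #1 2026-08-18T05:44:25Z (`HOME/pub-hodgecm-prl1-g3/lean/Prl1g3/IsotypicDecomposition.lean`, md5 4e761d86, 695 lines);
landed by the gen-6 packager in gate run 23 as `HodgeCM/Automorphic/IsotypicDecomposition.lean` (verbatim).
-/
/-
Origin: HOME/pub-hodgecm-prl1-g3/lean/Prl1g3/IsotypicDecomposition.lean — session planner-pub-hodgecm-prl1-g3-0
(unit pub-hodgecm-prl1-g3, EXPANSION PROVER a-1 gen 3: CONSTRUCT the realisation).
Intended final place (packager's call): `HodgeCM/Automorphic/IsotypicDecomposition.lean`; module rename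
`Prl1g3.` ↦ `HodgeCM.Automorphic.`.  Imports: the LANDED `HodgeCM.PerL34.SchurConstituents` (pv13, gate run 20;
⊇ `HodgeCM.PerL34.SchurUnitary`, run 19) and `HodgeCM.PerL34.Spectral` (pv09, run 17) + Mathlib.
NEW, ADDITIVE; touches no existing file.

KIND: L2 (definitions) + KERNEL.  NOTHING is cited or posited as a fact here.
-/
import Summits.HodgeConjecture.HodgeCM.PerL34.SchurConstituents
import Summits.HodgeConjecture.HodgeCM.PerL34.Spectral
import Mathlib.Analysis.InnerProductSpace.Projection.Submodule
import Mathlib.LinearAlgebra.Eigenspace.Basic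

set_option autoImplicit false

/-!
# Isotypic decomposition of a unitary representation — DEFINED, with the consumed axioms PROVED

Setting: a complex Hilbert space `H`, a group `G`, a monoid morphism `R : G →* (H →L[ℂ] H)` and the HYPOTHESIS
`IsUnitaryRep R` (`∀ g u v, ⟪R g u, R g v⟫ = ⟪u, v⟫` — verbatim the shape of the frozen interface field
`IsolationCore.R_unitary` / gen 2's `CoreCarrier.Analytic.R_unitary`).  Everything below is DEFINED from `R`:

* `IsIrreducible R V` — `V` is a non-zero closed `R`-invariant subspace with no closed `R`-invariant subspace other
  than `⊥` and `V` (an irreducible subrepresentation);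
* `Equiv R V W` — unitary equivalence of subrepresentations: an isometric linear bijection `V ≃ W` carrying `R g v`
  to `R g (e v)`; an equivalence relation on the irreducibles (`irrSetoid`), classes `IsoClass R`;
* `isotypic R c := ⨆ {V irreducible, ⟦V⟧ = c}, V` — the ISOTYPIC COMPONENT of the class `c` (its closure is the
  `σ̂` of PerL v5 l. 384–386);
* `Ew R ι w := ⨅ t, eigenspace (R (ι t)) (w t)` — the joint `w`-eigenspace of a family of group elements
  `ι : Tι → G` (PerL ll. 390–391: `T(L₀ ⊗ ℝ) ⊂ U(W)(𝔸)` acting through `R`, `w` its weight);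
* `WOccurs R ι w c` — "`w` occurs in `σ_∞|_T`": some irreducible of the class `c` meets `E_w` non-trivially.

PROVED (kernel; the functional-analytic input is pv13's Schur lemma `HodgeCM.PerL34.Schur.*` and pv09's
bicommutant lemma `HodgeCM.PerL34.Spectral.isotypic_projection_preserves`, both LANDED and USED BY NAME):

* `orthogonal_or_equiv` — two irreducible subrepresentations are orthogonal or unitarily equivalent;
* `isotypic_invariant`, `isotypic_orthogonal` (distinct classes ⟹ orthogonal components, also for the closures);
* `map_le_isotypic_of_mem_commutant` — every operator of the commutant `R(G)′` maps `isotypic c` into itself, hence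
  (`starProjection_isotypic_mem`) the orthogonal projection onto the closed isotypic component preserves every
  closed `R`-invariant subspace — the consumed form of PerL's "e_σ̂ lies in the von Neumann algebra of `R`"
  (AX9, ll. 386–387) — with NO completeness / discrete-decomposability hypothesis;
* `exists_wvector` — AX9 at `w` (ll. 435–437): a closed `R`-invariant `M` meeting the closed isotypic component of a
  class in which `w` occurs contains a non-zero vector of `E_w` inside that intersection.

These discharge, for a carrier whose `σ̂`, `E_w`, `wOccurs` are the objects defined here, the fields
`hatσ_invariant`, `hatσ_ortho`, `AX9_espectral` of `CoreCarrier.Analytic` and `AX9_w_vector` of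
`TorusCarrier.Analytic` (see the companion file `ThetaCarrierRep.lean` of this seat).  What is NOT proved here and stays a hypothesis there:
COMPLETENESS `(⨆ c, isotypic R c).topologicalClosure = ⊤` (discrete decomposability of `L²` of the compact quotient).
-/

noncomputable section

open scoped InnerProductSpace ComplexConjugate
open ContinuousLinearMap

namespace HodgeCM
namespace RepDecomp

open HodgeCM.PerL34 HodgeCM.PerL34.Spectral

variable {H : Type*} [NormedAddCommGroup H] [InnerProductSpace ℂ H] [CompleteSpace H]
variable {G : Type*} [Group G]

/-! ## 1. From the hypothesis `R_unitary` to bundled unitary representations -/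

section ToUnitary

variable (R : G →* (H →L[ℂ] H))

omit [CompleteSpace H] in
/-- (Ported verbatim from the HodgeCMPerL package; no docstring in the source.) -/
theorem mul_apply' (g h : G) (x : H) : R (g * h) x = R g (R h x) := by
  rw [map_mul]; rfl

omit [CompleteSpace H] in
/-- (Ported verbatim from the HodgeCMPerL package; no docstring in the source.) -/
theorem one_apply' (x : H) : R 1 x = x := by
  rw [map_one]; rfl

omit [CompleteSpace H] in
/-- (Ported verbatim from the HodgeCMPerL package; no docstring in the source.) -/
theorem apply_inv_apply (g : G) (x : H) : R g (R g⁻¹ x) = x := by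
  rw [← mul_apply', mul_inv_cancel, one_apply']

omit [CompleteSpace H] in
/-- (Ported verbatim from the HodgeCMPerL package; no docstring in the source.) -/
theorem inv_apply_apply (g : G) (x : H) : R g⁻¹ (R g x) = x := by
  rw [← mul_apply', inv_mul_cancel, one_apply']

variable {R} (hR : IsUnitaryRep R)
include hR

/-- `(R g)† = R g⁻¹`. -/
theorem adjoint_eq (g : G) : adjoint (R g) = R g⁻¹ := by
  symm
  rw [ContinuousLinearMap.eq_adjoint_iff]
  intro x y
  rw [hR.inner_apply_left, inv_inv]

/-- Each `R g` is a unitary operator. -/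
theorem mem_unitary (g : G) : R g ∈ unitary (H →L[ℂ] H) := by
  rw [Unitary.mem_iff, star_eq_adjoint, adjoint_eq hR]
  constructor
  · rw [← map_mul, inv_mul_cancel, map_one]
  · rw [← map_mul, mul_inv_cancel, map_one]

omit [CompleteSpace H] in
/-- `R` preserves norms. -/
theorem norm_map (g : G) (x : H) : ‖R g x‖ = ‖x‖ := by
  have h := hR g x x
  rw [inner_self_eq_norm_sq_to_K, inner_self_eq_norm_sq_to_K] at h
  have h' : (‖R g x‖ : ℝ) ^ 2 = ‖x‖ ^ 2 := by exact_mod_cast h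
  nlinarith [norm_nonneg (R g x), norm_nonneg x, sq_nonneg (‖R g x‖ - ‖x‖), sq_nonneg (‖R g x‖ + ‖x‖)]

/-- **The bundled unitary representation** `G →* unitary (H →L[ℂ] H)` of `(R, R_unitary)` — the form in which
pv13's Schur lemma (`HodgeCM.PerL34.Schur`) is stated. -/
def toUnitary : G →* unitary (H →L[ℂ] H) where
  toFun g := ⟨R g, mem_unitary hR g⟩
  map_one' := Subtype.ext (map_one R)
  map_mul' g h := Subtype.ext (map_mul R g h)

/-- (Ported verbatim from the HodgeCMPerL package; no docstring in the source.) -/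
@[simp] theorem coe_toUnitary (g : G) : ((toUnitary hR g : unitary (H →L[ℂ] H)) : H →L[ℂ] H) = R g := rfl

/-- (Ported verbatim from the HodgeCMPerL package; no docstring in the source.) -/
theorem ops_toUnitary : Schur.ops (toUnitary hR) = Set.range R := rfl

end ToUnitary

/-! ## 2. Invariant subspaces and subrepresentations -/

section SubRep

variable (R : G →* (H →L[ℂ] H))

/-- `R`-invariance of a submodule (definitionally gen 2's `CoreCarrier.Invariant`). -/
def Invariant (V : Submodule ℂ H) : Prop := ∀ (g : G), ∀ v ∈ V, R g v ∈ V

variable {R}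

/-- (Ported verbatim from the HodgeCMPerL package; no docstring in the source.) -/
theorem invariant_iff_schur (hR : IsUnitaryRep R) (V : Submodule ℂ H) :
    Invariant R V ↔ Schur.Invariant (Schur.ops (toUnitary hR)) V := by
  rw [ops_toUnitary]
  constructor
  · rintro h _ ⟨g, rfl⟩ v hv
    exact h g v hv
  · intro h g v hv
    exact h (R g) ⟨g, rfl⟩ v hv

omit [CompleteSpace H] in
/-- The closure of an invariant submodule is invariant. -/
theorem Invariant.topologicalClosure {V : Submodule ℂ H} (hV : Invariant R V) :
    Invariant R V.topologicalClosure := by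
  intro g v hv
  rw [← SetLike.mem_coe, Submodule.topologicalClosure_coe] at hv ⊢
  exact map_mem_closure (R g).continuous hv (fun w hw => hV g w hw)

omit [CompleteSpace H] in
/-- The orthogonal complement of an invariant submodule is invariant (unitarity). -/
theorem Invariant.orthogonal (hR : IsUnitaryRep R) {V : Submodule ℂ H} (hV : Invariant R V) :
    Invariant R Vᗮ := by
  intro g v hv
  exact Spectral.invariant_orthogonal hR.adjointClosed (Spectral.invariant_range_iff.mpr hV) (R g) ⟨g, rfl⟩ v hv

omit [CompleteSpace H] in
/-- (Ported verbatim from the HodgeCMPerL package; no docstring in the source.) -/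
theorem Invariant.inf {V W : Submodule ℂ H} (hV : Invariant R V) (hW : Invariant R W) : Invariant R (V ⊓ W) :=
  fun g _ hv => ⟨hV g _ hv.1, hW g _ hv.2⟩

omit [CompleteSpace H] in
/-- The orthogonal projection onto a closed invariant subspace commutes with `R`. -/
theorem Invariant.starProjection_commute (hR : IsUnitaryRep R) {V : Submodule ℂ H}
    [V.HasOrthogonalProjection] (hV : Invariant R V) (g : G) :
    R g * V.starProjection = V.starProjection * R g :=
  Spectral.starProjection_commute (hV g) (hV.orthogonal hR g)

omit [CompleteSpace H] in
/-- The restricted operators `R g|_V : V →L[ℂ] V` of an invariant submodule. -/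
def restrictHom (V : Submodule ℂ H) (hV : Invariant R V) : G →* (V →L[ℂ] V) where
  toFun g := (R g).restrict (hV g)
  map_one' := by
    refine ContinuousLinearMap.ext fun v => Subtype.ext ?_
    rw [ContinuousLinearMap.coe_restrict_apply, one_apply']
    rfl
  map_mul' g h := by
    refine ContinuousLinearMap.ext fun v => Subtype.ext ?_
    rw [ContinuousLinearMap.coe_restrict_apply, mul_apply']
    rfl

omit [CompleteSpace H] in
/-- (Ported verbatim from the HodgeCMPerL package; no docstring in the source.) -/
@[simp] theorem coe_restrictHom_apply (V : Submodule ℂ H) (hV : Invariant R V) (g : G) (v : V) :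
    ((restrictHom V hV g v : V) : H) = R g v := rfl

omit [CompleteSpace H] in
/-- (Ported verbatim from the HodgeCMPerL package; no docstring in the source.) -/
theorem isUnitaryRep_restrictHom (hR : IsUnitaryRep R) (V : Submodule ℂ H) (hV : Invariant R V) :
    IsUnitaryRep (restrictHom V hV) := by
  intro g u v
  rw [Submodule.coe_inner, Submodule.coe_inner, coe_restrictHom_apply, coe_restrictHom_apply]
  exact hR g u v

/-- **The subrepresentation** on a CLOSED invariant subspace, bundled as `G →* unitary (V →L[ℂ] V)`. -/
def subRep (hR : IsUnitaryRep R) (V : Submodule ℂ H) (hVc : IsClosed (V : Set H)) (hV : Invariant R V) :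
    haveI : CompleteSpace V := hVc.completeSpace_coe
    G →* unitary (V →L[ℂ] V) :=
  haveI : CompleteSpace V := hVc.completeSpace_coe
  toUnitary (isUnitaryRep_restrictHom hR V hV)

/-- (Ported verbatim from the HodgeCMPerL package; no docstring in the source.) -/
theorem coe_subRep_apply (hR : IsUnitaryRep R) (V : Submodule ℂ H) (hVc : IsClosed (V : Set H))
    (hV : Invariant R V) (g : G) (v : V) :
    haveI : CompleteSpace V := hVc.completeSpace_coe
    (((subRep hR V hVc hV g : unitary (V →L[ℂ] V)) : V →L[ℂ] V) v : H) = R g v := rfl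

end SubRep

/-! ## 3. Irreducible subrepresentations and unitary equivalence -/

section Irreducible

variable (R : G →* (H →L[ℂ] H))

/-- **Irreducible subrepresentation**: a non-zero CLOSED `R`-invariant subspace whose only closed `R`-invariant
subspaces are `⊥` and itself. -/
structure IsIrreducible (V : Submodule ℂ H) : Prop where
  isClosed : IsClosed (V : Set H)
  invariant : Invariant R V
  ne_bot : V ≠ ⊥
  irred : ∀ W : Submodule ℂ H, W ≤ V → IsClosed (W : Set H) → Invariant R W → W = ⊥ ∨ W = V

/-- **Unitary equivalence of subrepresentations** `V`, `W`: an isometric linear bijection `e : V ≃ W` that is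
`G`-equivariant — "if `v' = R g v` then `e v' = R g (e v)`" (coercion-free form; meaningful for invariant `V`). -/
def Equiv (V W : Submodule ℂ H) : Prop :=
  ∃ e : V ≃ₗᵢ[ℂ] W, ∀ (g : G) (v v' : V), (v' : H) = R g v → ((e v' : W) : H) = R g ((e v : W) : H)

variable {R}

omit [CompleteSpace H] in
/-- (Ported verbatim from the HodgeCMPerL package; no docstring in the source.) -/
theorem Equiv.refl (V : Submodule ℂ H) : Equiv R V V :=
  ⟨LinearIsometryEquiv.refl ℂ V, fun _ _ _ h => h⟩

omit [CompleteSpace H] in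
/-- (Ported verbatim from the HodgeCMPerL package; no docstring in the source.) -/
theorem Equiv.trans {V W X : Submodule ℂ H} (h₁ : Equiv R V W) (h₂ : Equiv R W X) : Equiv R V X := by
  obtain ⟨e₁, he₁⟩ := h₁
  obtain ⟨e₂, he₂⟩ := h₂
  exact ⟨e₁.trans e₂, fun g v v' h => he₂ g (e₁ v) (e₁ v') (he₁ g v v' h)⟩

omit [CompleteSpace H] in
/-- (Ported verbatim from the HodgeCMPerL package; no docstring in the source.) -/
theorem Equiv.symm {V W : Submodule ℂ H} (hV : Invariant R V) (h : Equiv R V W) : Equiv R W V := by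
  obtain ⟨e, he⟩ := h
  refine ⟨e.symm, fun g w w' hw' => ?_⟩
  have hv'' : R g ((e.symm w : V) : H) ∈ V := hV g _ (e.symm w).2
  have key : e ⟨R g ((e.symm w : V) : H), hv''⟩ = w' := by
    apply Subtype.ext
    rw [he g (e.symm w) ⟨R g ((e.symm w : V) : H), hv''⟩ rfl, hw', LinearIsometryEquiv.apply_symm_apply]
  rw [← key, LinearIsometryEquiv.symm_apply_apply]

omit [CompleteSpace H] in
/-- Equivalent invariant subspaces: a vector of `V` and its image have the same "eigen-behaviour" under any `R g`. -/
theorem Equiv.apply_smul {V W : Submodule ℂ H} (hV : Invariant R V) {e : V ≃ₗᵢ[ℂ] W}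
    (he : ∀ (g : G) (v v' : V), (v' : H) = R g v → ((e v' : W) : H) = R g ((e v : W) : H))
    (g : G) (a : ℂ) (v : V) (hv : R g (v : H) = a • (v : H)) : R g ((e v : W) : H) = a • ((e v : W) : H) := by
  have h := he g v ⟨R g (v : H), hV g _ v.2⟩ rfl
  rw [← h]
  have : (⟨R g (v : H), hV g _ v.2⟩ : V) = a • v := Subtype.ext (by rw [Submodule.coe_smul, ← hv])
  rw [this, map_smul, Submodule.coe_smul]

/-- An irreducible subrepresentation is an irreducible unitary representation in pv13's (`Schur`) sense. -/
theorem IsIrreducible.schurIrreducible (hR : IsUnitaryRep R) {V : Submodule ℂ H} (hV : IsIrreducible R V) :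
    haveI : CompleteSpace V := hV.isClosed.completeSpace_coe
    Schur.Irreducible (subRep hR V hV.isClosed hV.invariant) := by
  haveI : CompleteSpace V := hV.isClosed.completeSpace_coe
  intro K hKc hKinv
  let W : Submodule ℂ H := K.map V.subtype
  have hWle : W ≤ V := by
    rintro _ ⟨k, -, rfl⟩
    exact k.2
  have hWc : IsClosed (W : Set H) := by
    have hc : (W : Set H) = Subtype.val '' (K : Set V) := Submodule.map_coe _ _
    rw [hc]
    exact hKc.trans hV.isClosed
  have hWinv : Invariant R W := by
    rintro g _ ⟨k, hk, rfl⟩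
    exact ⟨((subRep hR V hV.isClosed hV.invariant g : unitary (V →L[ℂ] V)) : V →L[ℂ] V) k,
      hKinv _ ⟨g, rfl⟩ k hk, rfl⟩
  rcases hV.irred W hWle hWc hWinv with h | h
  · left
    rw [eq_bot_iff]
    intro k hk
    have hkW : (k : H) ∈ (⊥ : Submodule ℂ H) := by
      rw [← h]
      exact ⟨k, hk, rfl⟩
    rw [Submodule.mem_bot] at hkW ⊢
    exact Subtype.ext hkW
  · right
    rw [eq_top_iff]
    intro k _
    have hkW : (k : H) ∈ W := by
      rw [h]
      exact k.2
    obtain ⟨k', hk', hkk'⟩ := hkW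
    have hk'k : k' = k := Subtype.ext hkk'
    rw [← hk'k]
    exact hk'

/-- **Schur dichotomy.**  Two irreducible subrepresentations of a unitary representation are either ORTHOGONAL or
UNITARILY EQUIVALENT.  (The intertwiner `P_W|_V : V → H` is zero or — pv13's
`Schur.exists_linearIsometry_of_intertwiner_ne_zero` — a positive multiple of an equivariant isometry, whose
image is a non-zero closed invariant subspace of `W`, hence `W`.) -/
theorem orthogonal_or_equiv (hR : IsUnitaryRep R) {V W : Submodule ℂ H} (hV : IsIrreducible R V)
    (hW : IsIrreducible R W) : V ⟂ W ∨ Equiv R V W := by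
  haveI : CompleteSpace V := hV.isClosed.completeSpace_coe
  haveI : CompleteSpace W := hW.isClosed.completeSpace_coe
  have hρ := hV.schurIrreducible hR
  set ρ := subRep hR V hV.isClosed hV.invariant with hρdef
  set T : V →L[ℂ] H := W.starProjection ∘L V.subtypeL with hTdef
  have hTapply : ∀ v : V, T v = W.starProjection (v : H) := fun v => rfl
  have hT : Schur.Intertwines ρ (toUnitary hR) T := by
    intro g
    ext v
    show W.starProjection (R g (v : H)) = R g (W.starProjection (v : H))
    exact (congrArg (fun S : H →L[ℂ] H => S (v : H)) (hW.invariant.starProjection_commute hR g)).symm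
  by_cases h0 : T = 0
  · left
    rw [Submodule.isOrtho_iff_le]
    intro v hv
    have h1 : W.starProjection v = 0 := by
      have := congrArg (fun S : V →L[ℂ] H => S ⟨v, hv⟩) h0
      simpa [hTapply] using this
    exact W.starProjection_apply_eq_zero_iff.mp h1
  · right
    obtain ⟨U, ⟨a, _, hUa⟩, hU⟩ := Schur.exists_linearIsometry_of_intertwiner_ne_zero hρ hT h0
    have hUW : ∀ x, U x ∈ W := fun x => by
      rw [hUa x, hTapply]
      exact W.smul_mem _ (W.starProjection_apply_mem _)
    let K : Submodule ℂ H := LinearMap.range U.toLinearMap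
    have hKW : K ≤ W := by
      rintro _ ⟨x, rfl⟩
      exact hUW x
    have hKc : IsClosed (K : Set H) := by
      have hc : (K : Set H) = Set.range U := by
        ext y
        simp [K]
      rw [hc]
      exact U.isometry.isClosedEmbedding.isClosed_range
    have hKinv : Invariant R K := by
      rintro g _ ⟨x, rfl⟩
      exact ⟨((ρ g : unitary (V →L[ℂ] V)) : V →L[ℂ] V) x, hU g x⟩
    have hK0 : K ≠ ⊥ := by
      obtain ⟨v, hv, hv0⟩ := Submodule.exists_mem_ne_zero_of_ne_bot hV.ne_bot
      rw [Submodule.ne_bot_iff]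
      refine ⟨U ⟨v, hv⟩, ⟨⟨v, hv⟩, rfl⟩, fun h => hv0 ?_⟩
      have hn := U.norm_map ⟨v, hv⟩
      rw [h, norm_zero, Submodule.coe_norm] at hn
      exact norm_eq_zero.mp hn.symm
    have hKeq : K = W := (hW.irred K hKW hKc hKinv).resolve_left hK0
    let U₀ : V →ₗᵢ[ℂ] W :=
      { toLinearMap := LinearMap.codRestrict W U.toLinearMap hUW
        norm_map' := fun x => by
          rw [Submodule.coe_norm]
          exact U.norm_map x }
    have hU₀ : ∀ x, ((U₀ x : W) : H) = U x := fun x => rfl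
    have hsurj : Function.Surjective U₀ := by
      rintro ⟨w, hw⟩
      rw [← hKeq] at hw
      obtain ⟨x, rfl⟩ := hw
      exact ⟨x, rfl⟩
    refine ⟨LinearIsometryEquiv.ofSurjective U₀ hsurj, fun g v v' hv' => ?_⟩
    have hvv : v' = ((ρ g : unitary (V →L[ℂ] V)) : V →L[ℂ] V) v := Subtype.ext (hv'.trans rfl)
    rw [LinearIsometryEquiv.coe_ofSurjective, hU₀, hU₀, hvv]
    exact hU g v

variable (R)

/-- The irreducible subrepresentations of `R`. -/
abbrev Irr : Type _ := {V : Submodule ℂ H // IsIrreducible R V}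

/-- Unitary equivalence is an equivalence relation on the irreducible subrepresentations. -/
def irrSetoid : Setoid (Irr R) where
  r V W := Equiv R V.1 W.1
  iseqv := ⟨fun V => Equiv.refl V.1, fun {V _} h => h.symm V.2.invariant, fun h₁ h₂ => h₁.trans h₂⟩


-- port_pkg: scope closed for this part
end Irreducible
end RepDecomp
end HodgeCM
end
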